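import Summits.MatrixMultiplication.OmegaCensus.STPP122RankThreeMechanism
import Summits.MatrixMultiplication.OmegaCensus.STPPSmallPatternTableWitnessesT2B

/-!
# (1,2,2)^k STPP families: the ROOM LAW for a further triple, and `T2(𝔽₃³) = 3` BY ROOM (kernel, unconditional)

Cell `pub-omega` (unit `pub-omega-stpp-1-g35`), topic `Summits/MatrixMultiplication/OmegaCensus`.
HONEST FRAMING (verbatim): lottery ticket; floor = certified bounds/negative ranges. Census STRUCTURE bookkeeping (C10 / X-38: the
MECHANISM of the cell `(k, |G|) = (3, 27)` of the threshold column `T2(H) = max {k : (1,2,2)^k ⊆ H}`); nothing here is a bound on `ω`.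

WHAT IS PROVED.
* `GLNF.disjoint_diffSet_init_sub_last` — **the disjointness half of the room principle** (any `p`, any `k`, any cards): in an STPP
  family of `k + 2` triples of `(ℤ/p)³`, the difference set `B_last − C_last` of the LAST triple is disjoint from the difference set
  `GLNF.diffSet = (⋃ᵢ (Bᵢ − Aᵢ)) − (⋃ⱼ (Cⱼ − Aⱼ))` of the OTHER `k + 1` triples (one instance of the STPP word condition with the index
  pattern `(i, last, j)`); the monotonicity half is `GLNF.diffSet_mono` (`STPP122AffineWLOG`).
* `GLNF.card_sub_eq_mul_of_isSTPP` — the TPP of one member: `#(Bᵢ − Cᵢ) = #Bᵢ · #Cᵢ` as soon as `Aᵢ ≠ ∅` (any abelian group).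
* `GLNF.room_law` — **ROOM LAW:** `#diffSet(first k+1 triples) + #B_last · #C_last ≤ |V|` for every STPP family of `k + 2` triples of
  `(ℤ/p)³` with `A_last ≠ ∅`.
* `Rank3Cert.no_fourth_block` — **no `(1,2,2)⁴` STPP family in `(ℤ/3)³`, BY ROOM:** the first three triples cover `≥ 24` of the `27`
  points (`Rank3Cert.rank3_room`, `STPP122RankThreeMechanism`), the fourth needs `2 · 2 = 4` fresh ones; `24 + 4 > 27`.
* `Rank3Cert.stpp122_T2_z3_z3_z3_eq_3_by_room` — **`T2(𝔽₃³) = 3` exactly**, the lower half by the tree's explicit family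
  (`exists_isSTPP_122pow3_zmod3_zmod3_zmod3`, ENG2), the upper half BY ROOM. (The tree's `stpp122_T2_z3_z3_z3_eq_3`,
  `STPPSmallPatternNone122K4P3x3x3`, decides the same cell by kernel search; this file is the structural reading of X-38.)

References: H. Cohn, R. Kleinberg, B. Szegedy, C. Umans, FOCS 2005 (arXiv:math/0511460), Def. 5.1.
-/

namespace Summit.MatrixMultiplication.OmegaCensus

open Finset Pointwise Literature.Computability.AlgebraicComplexity

namespace GLNF

variable {p : ℕ} {k : ℕ}

/-! ## The disjointness half of the room principle -/

/-- **Disjointness half of the room principle.** In an STPP family of `k + 2` triples, the difference set `B_last − C_last` of the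
last triple misses the difference set `(⋃ᵢ (Bᵢ − Aᵢ)) − (⋃ⱼ (Cⱼ − Aⱼ))` of the first `k + 1` triples: an equality
`(b − a) − (c − a') = b' − c'` (`b ∈ Bᵢ, a ∈ Aᵢ, c ∈ Cⱼ, a' ∈ Aⱼ, b' ∈ B_last, c' ∈ C_last`) is the STPP word
`(a − a') + (b' − b) + (c − c') = 0` with index pattern `(i, last, j)`, forcing `i = last`. [cite: CohnKleinbergSzegedyUmans2005, Def. 5.1] -/
theorem disjoint_diffSet_init_sub_last {A B C : Fin (k + 2) → Finset (V p)} (hS : IsSTPP A B C) :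
    Disjoint (diffSet (fun i : Fin (k + 1) => A i.castSucc) (fun i => B i.castSucc) (fun i => C i.castSucc))
      (B (Fin.last (k + 1)) - C (Fin.last (k + 1))) := by
  rw [Finset.disjoint_left]
  intro x hx hx'
  obtain ⟨i, j, b, hb, a, ha, c, hc, a', ha', rfl⟩ := mem_diffSet.1 hx
  obtain ⟨b', hb', c', hc', he⟩ := mem_sub.1 hx'
  have h := hS i.castSucc (Fin.last (k + 1)) j.castSucc a' ha' a ha b hb b' hb' c' hc' c hc
    (by rw [← sub_eq_zero.2 he]; abel)
  exact (Fin.castSucc_lt_last i).ne h.1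

/-! ## The TPP of one member: `#(Bᵢ − Cᵢ) = #Bᵢ · #Cᵢ` -/

/-- In an STPP family, the difference map `(b, c) ↦ b − c` is injective on `Bᵢ ×ˢ Cᵢ` whenever `Aᵢ` is non-empty (the TPP of the
`i`-th triple, word `(a − a) + (b − b') + (c' − c) = 0`), so `#(Bᵢ − Cᵢ) = #Bᵢ · #Cᵢ`. [cite: CohnKleinbergSzegedyUmans2005, Def. 5.1] -/
theorem card_sub_eq_mul_of_isSTPP {H : Type*} [AddCommGroup H] [DecidableEq H] {N : ℕ} {A B C : Fin N → Finset H}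
    (hS : IsSTPP A B C) (i : Fin N) (hA : (A i).Nonempty) : (B i - C i).card = (B i).card * (C i).card := by
  obtain ⟨a, ha⟩ := hA
  rw [Finset.sub_def, card_image_of_injOn, card_product]
  rintro ⟨b, c⟩ hbc ⟨b', c'⟩ hbc' (he : b - c = b' - c')
  rw [coe_product, Set.mem_prod, mem_coe, mem_coe] at hbc hbc'
  obtain ⟨-, -, -, hbb, hcc⟩ := hS i i i a ha a ha b' hbc'.1 b hbc.1 c hbc.2 c' hbc'.2
    (by rw [sub_self, zero_add, ← sub_eq_zero.2 he]; abel)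
  rw [hbb, hcc]

/-! ## The room law -/

/-- **ROOM LAW.** For an STPP family of `k + 2` triples of `(ℤ/p)³` whose last `A`-set is non-empty,
`#diffSet(first k + 1 triples) + #B_last · #C_last ≤ |(ℤ/p)³|`: the last triple's `#B_last · #C_last` differences are fresh points.
[cite: CohnKleinbergSzegedyUmans2005, Def. 5.1] -/
theorem room_law [NeZero p] {A B C : Fin (k + 2) → Finset (V p)} (hS : IsSTPP A B C) (hA : (A (Fin.last (k + 1))).Nonempty) :
    (diffSet (fun i : Fin (k + 1) => A i.castSucc) (fun i => B i.castSucc) (fun i => C i.castSucc)).card +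
      (B (Fin.last (k + 1))).card * (C (Fin.last (k + 1))).card ≤ Fintype.card (V p) := by
  rw [← card_sub_eq_mul_of_isSTPP hS (Fin.last (k + 1)) hA, ← card_union_of_disjoint (disjoint_diffSet_init_sub_last hS)]
  exact card_le_univ _

end GLNF

namespace Rank3Cert

open GLNF

/-! ## `T2(𝔽₃³) = 3` by room -/

/-- **No `(1,2,2)⁴` STPP family in `ℤ/3 × ℤ/3 × ℤ/3`, BY ROOM** (the mechanism of the census cell `(3, 27)`, X-38): the first three
triples have a difference set of `≥ 24` points (`rank3_room`), the fourth triple's `2 · 2 = 4` differences must avoid it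
(`GLNF.room_law`), and `24 + 4 > 27`. [cite: CohnKleinbergSzegedyUmans2005, Def. 5.1] -/
theorem no_fourth_block : ¬ ∃ A B C : Fin 4 → Finset (ZMod 3 × ZMod 3 × ZMod 3), IsSTPP A B C ∧
    ∀ i, (A i).card = 1 ∧ (B i).card = 2 ∧ (C i).card = 2 := by
  rintro ⟨A, B, C, hS, hc⟩
  have hroom := room_law (k := 2) hS (card_pos.1 (by rw [(hc (Fin.last 3)).1]; norm_num))
  have h3 : 24 ≤ (diffSet (fun i : Fin (2 + 1) => A i.castSucc) (fun i => B i.castSucc) (fun i => C i.castSucc)).card :=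
    rank3_room (hS.comp_of_injective Fin.castSucc (Fin.castSucc_injective 3)) fun i => hc i.castSucc
  rw [(hc (Fin.last 3)).2.1, (hc (Fin.last 3)).2.2] at hroom
  have hV : Fintype.card (V 3) = 27 := rfl
  omega

/-- **`T2(𝔽₃³) = 3` EXACTLY, the upper half BY ROOM:** `(ℤ/3)³` hosts a `(1,2,2)³` STPP family (explicit, `decide`) and hosts no
`(1,2,2)⁴` family because three triples leave fewer than four free difference points (`no_fourth_block`).
[cite: CohnKleinbergSzegedyUmans2005, Def. 5.1] -/
theorem stpp122_T2_z3_z3_z3_eq_3_by_room :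
    (∃ A B C : Fin 3 → Finset (ZMod 3 × ZMod 3 × ZMod 3), IsSTPP A B C ∧ ∀ i, (A i).card = 1 ∧ (B i).card = 2 ∧ (C i).card = 2) ∧
    ¬ ∃ A B C : Fin 4 → Finset (ZMod 3 × ZMod 3 × ZMod 3), IsSTPP A B C ∧ ∀ i, (A i).card = 1 ∧ (B i).card = 2 ∧ (C i).card = 2 :=
  ⟨exists_isSTPP_122pow3_zmod3_zmod3_zmod3, no_fourth_block⟩

end Rank3Cert

end Summit.MatrixMultiplication.OmegaCensus
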